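import Literature.AlgebraicGeometry.Resolution.TranscendenceDefect
import Literature.AlgebraicGeometry.Resolution.ValuedFunctionFields
import Mathlib.LinearAlgebra.Dimension.Finite
import HarnessLib

/-!
# Transcendentally immediate extensions; the fibration of Temkin's Thm. 4.1.1, Step 1

Topic: `Literature/AlgebraicGeometry/Resolution`. Continues `TranscendenceDefect.lean` (the
invariants `E = ratRank O`, `F = residueTrdeg k O hk`, `D = transcendenceDefect k O hk` of a valued
field `(K, O)` over a trivially valued subfield `k ⊆ O`; Abhyankar's inequality) with the rest of
§2.1 of M. Temkin, *Inseparable local uniformization*, J. Algebra 373 (2013) 65–119 =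
arXiv:0804.1554v3 (numbers and pages of the journal version = v3) that the induction step of the
proof of Thm. 4.1.1 uses, and PROVES the first sentence of that step (p. 47, Step 1: "Since
`D_{K/k} > 0`, it follows from Remark 2.1.2 that there exists a valued subfield `k̄ ↪ K` containing
`k` and such that `tr.deg._{k̄}(K) = 1` and `K/k̄` is transcendentally immediate; in particular,
`D_{k̄/k} = D - 1`"; the same fibration opens §4.2, Step 1, p. 50). Everything here is PROVED.

* `IsTranscendentallyImmediateOver V k l` — "the extension is transcendentally immediate if
  `E = F = 0`, i.e. `l̃/k̃` is algebraic and `|l^×|/|k^×|` is torsion" (p. 9), for subfields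
  `k ≤ l` of an ambient valued field `(Ω, V)`, as the conjunction of the tree's
  `IsValueTorsionOver` and `IsResiduallyAlgebraicOver` (`ValuedFunctionFields.lean`, the
  Knaf–Kuhlmann rendering; here `Ω = K`, `V = O = K°`, `l = ⊤`).
* `IsValueIndependent O y` — non-zero `y_j` with `ℤ`-independent values, elementarily (a monomial
  `∏ y_j ^ {g_j}`, `g_j ∈ ℤ`, of value `1` is trivial); `↔` linear independence of the values in
  `Γ_O` (`isValueIndependent_iff_linearIndependent`); `e` such elements show `e ≤ E` and `e ≤ E`
  is so witnessed (`IsValueIndependent.natCast_le_ratRank`,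
  `exists_isValueIndependent_of_natCast_le_ratRank`); for `e = E < ℵ₀` every non-zero value is
  torsion over them (`IsValueIndependent.exists_pow_valuation_eq`).
* Restriction to a subfield `F ⊆ K` (valuation ring `O ∩ F = O.comap (algebraMap F K)`):
  `E(O ∩ F) ≤ E(O)` (`ratRank_comap_le`), `F(O ∩ F) ≤ F(O)` (`residueTrdeg_comap_le`, via the
  `k`-embedding of residue fields `residueFieldComapAlgHom`), with equality as soon as `F`
  contains a value basis, resp. lifts of a residual transcendence basis
  (`ratRank_comap_eq_of_isValueIndependent`, `natCast_le_residueTrdeg_comap`).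
* `exists_abhyankar_system` — for `tr.deg._k(K) < ℵ₀` there are a value-independent
  `y : Fin E → K` and `x : Fin F → O` whose residues form a transcendence basis of `K̃/k`
  (condition (*) of p. 9); such a system `B = (y, x)` is algebraically independent
  (`algebraicIndependent_abhyankar_system`, from `algebraicIndependent_sumElim_of_valuation`) and,
  for EVERY intermediate field `L ⊇ B`: `E(O ∩ L) = E`, `F(O ∩ L) = F` and `K/L` is
  transcendentally immediate (`ratRank_comap_intermediateField`,
  `residueTrdeg_comap_intermediateField`, `isTranscendentallyImmediateOver_intermediateField`).
* `trdeg_adjoin_eq_and_trdeg_eq` — splitting a finite transcendence basis `x : ι → K` at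
  `s ⊆ ι`: `tr.deg._k k(x(s)) = #s`, `tr.deg._{k(x(s))} K = #sᶜ`.
* `exists_adjoin_isTranscendentallyImmediateOver` — **Remark 2.1.2**, PROVED (finite `N`): the
  tower `K / k(B) / k` has Abhyankar bottom (`D_{k(B)/k} = 0`, `tr.deg._k k(B) = E + F`) and
  transcendentally immediate top, `E_{k(B)} = E`, `F_{k(B)} = F`, and `tr.deg._{k(B)}(K) = D_{K/k}`.
* `exists_intermediateField_trdeg_eq_one_isTranscendentallyImmediateOver` — **Thm. 4.1.1, Step 1,
  first sentence**, PROVED: for `K/k` finitely generated with `D_{K/k} > 0` there is a finitely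
  generated intermediate field `k̄` with `tr.deg._{k̄}(K) = 1`, `K/k̄` transcendentally immediate,
  `E_{k̄} = E`, `F_{k̄} = F`, `tr.deg._k(k̄) = N - 1` and `D_{k̄/k} = D - 1` (take a transcendence
  basis `T ⊇ B`, `c₀ ∈ T ∖ B` — it exists because `#B = E + F < N` — and `k̄ = k(T ∖ {c₀})`).

* `exists_intermediateField_valuation_eq_one_isResiduallyAlgebraicOver` — **§4.2, Step 1, the
  choice of `k̄ = k(b)`**, PROVED: for any valuation ring `O ⊇ k` of `K` (`tr.deg._k(K) < ℵ₀`) a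
  finitely generated `k̄ = k(b)`, `b ⊂ O` lifting a transcendence basis of `K̃/k`, with
  `tr.deg._k(k̄) = F`, `v = 1` on `k̄^×` (the valuation is trivial on `k̄ ⊆ O`) and `K̃` algebraic
  over the residue field of `k̄` — the fibration opening the induction step on the height
  (`Temkin2013HeightStepOfDescent`, `InseparableLocalUniformizationDescent.lean`), applied there
  to the coarsening `F°` of `K°`.

This is the input "Remark 2.1.2" of the named fact `Temkin2013DescentDefectStep`
(`InseparableLocalUniformizationDefect.lean`); the remaining inputs of that step (Thm. 3.3.1,
Prop. 2.3.8, Lemmas 2.3.9, 2.8.4, 2.8.5) involve nft schemes over valuation rings and Berkovich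
curves.

## Sources

* M. Temkin, *Inseparable local uniformization*, J. Algebra 373 (2013) 65–119 =
  arXiv:0804.1554v3, §2.1 (pp. 9–10: `E`, `F`, transcendentally immediate extensions, condition
  (*), Remark 2.1.2) and the proof of Thm. 4.1.1, Step 1 (p. 47); §4.2, Step 1 (p. 50).
* H. Knaf, F.-V. Kuhlmann, *Abhyankar places admit local uniformization in any characteristic*,
  Ann. Sci. ÉNS 38 (2005) 833–846, Thm. 2.1 (algebraic independence of such systems; vendored and
  proved in `TranscendenceDefect.lean`).

## Rendering notes

* As in `TranscendenceDefect.lean`: `k` trivially valued ↦ `hk : ∀ c, algebraMap k K c ∈ O`, the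
  `k`-structure on `O` is `algebraOfMem k O hk` (statements about residues carry
  `letI := algebraOfMem k O hk`).
* The valued subfield `k̄` of the source is an `IntermediateField k K` valued by
  `O.comap (algebraMap k̄ K) = O ∩ k̄`; its invariants are the tree's `ratRank`, `residueTrdeg`,
  `transcendenceDefect` of that valuation ring (`k ⊆ O ∩ k̄`: `algebraMap_mem_comap`), and
  "`K/k̄` transcendentally immediate" is `IsTranscendentallyImmediateOver O k̄.toSubfield ⊤`.
* `D_{k̄/k} = D - 1` is stated as `D_{k̄/k} + 1 = D` (no truncated subtraction).
-/

noncomputable section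

open IsLocalRing Cardinal

namespace Literature.AlgebraicGeometry.Resolution

universe u

variable {K : Type u} [Field K]

/-! ### Transcendentally immediate extensions (Temkin 2013, §2.1) -/

/-- **Transcendentally immediate extension of valued fields** (Temkin 2013, §2.1, p. 9: "for any
extension `l/k` of valued fields set `E = E_{l/k} = dim_ℚ(|l^×|/|k^×| ⊗_ℤ ℚ)` and
`F = F_{l/k} = tr.deg._{k̃}(l̃)`. … We say that the extension is transcendentally immediate if
`E = F = 0`, i.e. `l̃/k̃` is algebraic and `|l^×|/|k^×|` is torsion"), for subfields `k ≤ l` of an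
ambient valued field `(Ω, V)` (the rendering of `ValuedFunctionFields.lean`): the value group of
`l` is torsion modulo that of `k` (`IsValueTorsionOver`) and the residue field of `l` is
algebraic over that of `k` (`IsResiduallyAlgebraicOver`). [cite: Temkin2013, Section 2.1 (p. 9)] -/
def IsTranscendentallyImmediateOver (V : ValuationSubring K) (k l : Subfield K) : Prop :=
  IsValueTorsionOver V k l ∧ IsResiduallyAlgebraicOver V k l

/-- Unfolding lemma. [folklore] -/
theorem isTranscendentallyImmediateOver_iff (V : ValuationSubring K) (k l : Subfield K) :
    IsTranscendentallyImmediateOver V k l ↔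
      IsValueTorsionOver V k l ∧ IsResiduallyAlgebraicOver V k l :=
  Iff.rfl

/-! ### Units of a valuation ring and restriction to a subfield -/

section units

variable (O : ValuationSubring K)

/-- `v(x) = 1` iff `x` and `x⁻¹` lie in `O` (for `x ≠ 0`). [folklore] -/
theorem valuation_eq_one_iff_mem_and_inv_mem {x : K} (hx : x ≠ 0) :
    O.valuation x = 1 ↔ x ∈ O ∧ x⁻¹ ∈ O := by
  rw [← O.valuation_le_one_iff, ← O.valuation_le_one_iff, map_inv₀]
  have h0 : 0 < O.valuation x := zero_lt_iff.mpr (valuation_ne_zero_of_ne_zero O hx)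
  rw [inv_le_one₀ h0]
  exact ⟨fun h => ⟨h.le, h.ge⟩, fun h => le_antisymm h.1 h.2⟩

variable {F : Type u} [Field F] [Algebra F K]

/-- The valuation ring `O ∩ F` of a subfield has units `O^× ∩ F`: for `x ∈ F`,
`v_F(x) = 1 ↔ v(x) = 1`. [folklore] -/
theorem valuation_comap_eq_one_iff (x : F) :
    (O.comap (algebraMap F K)).valuation x = 1 ↔ O.valuation (algebraMap F K x) = 1 := by
  by_cases hx : x = 0
  · subst hx; simp
  rw [valuation_eq_one_iff_mem_and_inv_mem _ hx,
    valuation_eq_one_iff_mem_and_inv_mem _ ((map_ne_zero (algebraMap F K)).mpr hx),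
    ValuationSubring.mem_comap, ValuationSubring.mem_comap, map_inv₀]

/-- The inclusion `O ∩ F → O` of valuation rings along a subfield `F ⊆ K`. [folklore] -/
def comapInclusion : O.comap (algebraMap F K) →+* O :=
  ((algebraMap F K).comp (O.comap (algebraMap F K)).subtype).codRestrict O
    fun x => ValuationSubring.mem_comap.mp x.2

/-- `O ∩ F → O` is the inclusion on underlying elements. [folklore] -/
@[simp]
theorem coe_comapInclusion_apply (x : O.comap (algebraMap F K)) :
    (comapInclusion O x : K) = algebraMap F K x :=
  rfl

/-- `O ∩ F → O` is a local homomorphism. [folklore] -/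
instance isLocalHom_comapInclusion : IsLocalHom (comapInclusion (F := F) O) := by
  refine ⟨fun x hx => ?_⟩
  rw [ValuationSubring.valuation_eq_one_iff] at hx ⊢
  exact (valuation_comap_eq_one_iff O (x : F)).mpr hx

end units

/-! ### Value-independent families and the rational rank -/

section valueIndependent

variable (O : ValuationSubring K)

/-- **Value-independent family**: non-zero `y_j ∈ K` whose values are `ℤ`-linearly independent in
the value group, elementarily: a monomial `∏_{j ∈ s} y_j ^ {g_j}` (`g_j ∈ ℤ`) of value `1` has
all `g_j = 0` (Temkin 2013, §2.1, condition (*) on `B_E`: "the projection of `l^×` onto the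
'multiplicative' `ℚ`-vector space `(|l^×|/|k^×|) ⊗_ℤ ℚ` maps `B_E` bijectively onto a `ℚ`-basis";
for a trivially valued `k` and a FINITE `E`, a maximal such family). Equivalent to linear
independence in `Γ_O` (`isValueIndependent_iff_linearIndependent`). [cite: Temkin2013, Section 2.1 (p. 9)] -/
def IsValueIndependent {κ : Type*} (y : κ → K) : Prop :=
  (∀ j, y j ≠ 0) ∧
    ∀ (s : Finset κ) (g : κ → ℤ), O.valuation (∏ j ∈ s, y j ^ g j) = 1 → ∀ j ∈ s, g j = 0

/-- **`ℤ`-independence of values, elementarily.** For non-zero `y_j`, the values `v(y_j) ∈ Γ_O`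
(units of the value group, written additively) are `ℤ`-linearly independent iff `y` is
value-independent. [folklore] -/
theorem linearIndependent_valuation_iff {κ : Type*} (y : κ → K) (hy0 : ∀ j, y j ≠ 0) :
    LinearIndependent ℤ (fun j =>
      Additive.ofMul (Units.mk0 (O.valuation (y j)) (valuation_ne_zero_of_ne_zero O (hy0 j)))) ↔
    ∀ (s : Finset κ) (g : κ → ℤ), O.valuation (∏ j ∈ s, y j ^ g j) = 1 → ∀ j ∈ s, g j = 0 := by
  classical
  set u : κ → (ValuationSubring.ValueGroup O)ˣ := fun j =>
    Units.mk0 (O.valuation (y j)) (valuation_ne_zero_of_ne_zero O (hy0 j)) with hu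
  have hprod : ∀ (s : Finset κ) (g : κ → ℤ), O.valuation (∏ j ∈ s, y j ^ g j) =
      ((∏ j ∈ s, u j ^ g j : (ValuationSubring.ValueGroup O)ˣ) : ValuationSubring.ValueGroup O) := by
    intro s g
    simp only [map_prod, map_zpow₀, Units.coe_prod, Units.val_zpow_eq_zpow_val, hu, Units.val_mk0]
  have hlin : ∀ (s : Finset κ) (g : κ → ℤ), ∑ j ∈ s, g j • Additive.ofMul (u j) =
      Additive.ofMul (∏ j ∈ s, u j ^ g j) := by
    intro s g
    simp only [ofMul_prod, ofMul_zpow]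
  rw [linearIndependent_iff']
  refine forall_congr' fun s => forall_congr' fun g => ?_
  rw [hlin, ofMul_eq_zero, ← Units.val_eq_one, ← hprod]

/-- `IsValueIndependent ↔` linear independence of the values. [folklore] -/
theorem isValueIndependent_iff_linearIndependent {κ : Type*} (y : κ → K) (hy0 : ∀ j, y j ≠ 0) :
    IsValueIndependent O y ↔ LinearIndependent ℤ (fun j =>
      Additive.ofMul (Units.mk0 (O.valuation (y j)) (valuation_ne_zero_of_ne_zero O (hy0 j)))) := by
  rw [linearIndependent_valuation_iff O y hy0]
  exact ⟨fun h => h.2, fun h => ⟨hy0, h⟩⟩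

/-- A value-independent family is injective on exponents: distinct monomials (with exponents in
`ℕ`) have distinct values (so `algebraicIndependent_sumElim_of_valuation` applies). [folklore] -/
theorem IsValueIndependent.injective_prod_pow {κ : Type*} {y : κ → K}
    (hy : IsValueIndependent O y) :
    Function.Injective fun μ : κ →₀ ℕ => O.valuation (μ.prod fun j n => y j ^ n) :=
  injective_valuation_prod_pow O y hy.1 ((isValueIndependent_iff_linearIndependent O y hy.1).mp hy)

/-- A value-independent family of size `e` shows `e ≤ E = ratRank O`. [folklore] -/
theorem IsValueIndependent.natCast_le_ratRank {e : ℕ} {y : Fin e → K}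
    (hy : IsValueIndependent O y) : (e : Cardinal) ≤ ratRank O := by
  have hli := (isValueIndependent_iff_linearIndependent O y hy.1).mp hy
  unfold ratRank
  simpa using hli.cardinal_lift_le_rank

/-- Conversely `e ≤ E` is witnessed by a value-independent family of size `e`. [folklore] -/
theorem exists_isValueIndependent_of_natCast_le_ratRank {e : ℕ}
    (he : (e : Cardinal) ≤ ratRank O) : ∃ y : Fin e → K, IsValueIndependent O y := by
  obtain ⟨f, hf⟩ := exists_linearIndependent_of_le_rank he
  -- lift the values
  choose y hy using fun j : Fin e => O.valuation_surjective
    (((Additive.toMul (f j) : (ValuationSubring.ValueGroup O)ˣ) : ValuationSubring.ValueGroup O))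
  have hy0 : ∀ j, y j ≠ 0 := by
    intro j h
    have := hy j
    rw [h, map_zero] at this
    exact (Units.ne_zero _) this.symm
  refine ⟨y, (isValueIndependent_iff_linearIndependent O y hy0).mpr ?_⟩
  have : (fun j => Additive.ofMul
      (Units.mk0 (O.valuation (y j)) (valuation_ne_zero_of_ne_zero O (hy0 j)))) = f :=
    funext fun j => by
      have hu : Units.mk0 (O.valuation (y j)) (valuation_ne_zero_of_ne_zero O (hy0 j)) =
          Additive.toMul (f j) := Units.ext (hy j)
      rw [hu]; rfl
  rwa [this]

/-- **Values outside a maximal independent family are torsion over it**: if `y₁, …, y_e` is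
value-independent with `e = E(O)` finite, then for every `a ≠ 0` some `a ^ n`, `n ≠ 0`, has the
value of a monomial `∏ y_j ^ {g_j}`, `g_j ∈ ℤ` (an `(e+1)`-st independent value would give
`e + 1 ≤ E`). [folklore] -/
theorem IsValueIndependent.exists_pow_valuation_eq {e : ℕ} (he : ratRank O = e) {y : Fin e → K}
    (hy : IsValueIndependent O y) {a : K} (ha : a ≠ 0) :
    ∃ n : ℕ, n ≠ 0 ∧ ∃ g : Fin e → ℤ, (O.valuation (a ^ n) = O.valuation (∏ j, y j ^ g j) ∨
      O.valuation (a ^ n) = O.valuation (∏ j, y j ^ g j)⁻¹) := by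
  classical
  -- the extended family `(a, y₁, …, y_e)` is not value-independent
  set w : Fin (e + 1) → K := Fin.cons a y with hw
  have hw0 : ∀ i, w i ≠ 0 := fun i => by
    refine Fin.cases ?_ (fun j => ?_) i
    · simpa [hw] using ha
    · simpa [hw] using hy.1 j
  have hnot : ¬ IsValueIndependent O w := by
    intro hW
    have h1 : ((e + 1 : ℕ) : Cardinal) ≤ ratRank O := hW.natCast_le_ratRank
    rw [he] at h1
    norm_cast at h1
    omega
  unfold IsValueIndependent at hnot
  push Not at hnot
  obtain ⟨s, g, hsg, i, his, hgi⟩ := hnot hw0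
  -- extend `g` by zero outside `s`
  set g' : Fin (e + 1) → ℤ := fun i => if i ∈ s then g i else 0 with hg'
  have hprod : ∏ j, w j ^ g' j = ∏ j ∈ s, w j ^ g j := by
    rw [← Finset.prod_subset (Finset.subset_univ s)]
    · exact Finset.prod_congr rfl fun j hj => by simp [hg', hj]
    · intro j _ hj; simp [hg', hj]
  have hval : O.valuation (∏ j, w j ^ g' j) = 1 := by rw [hprod]; exact hsg
  -- the coefficient of `a` is non-zero, by value-independence of `y`
  have hg0 : g' 0 ≠ 0 := by
    intro h0
    rw [Fin.prod_univ_succ, h0, zpow_zero, one_mul] at hval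
    have hval' : O.valuation (∏ j ∈ Finset.univ, y j ^ g' j.succ) = 1 := by
      simpa [hw] using hval
    have := hy.2 Finset.univ (fun j => g' j.succ) hval'
    -- then `g` vanishes on `s`, contradicting `hgi`
    apply hgi
    have hi' : g' i = 0 :=
      Fin.cases (motive := fun i => g' i = 0) h0 (fun j => this j (Finset.mem_univ _)) i
    simpa [hg', his] using hi'
  -- `v(a ^ g'₀ · ∏ y_j ^ g'_{j+1}) = 1`
  rw [Fin.prod_univ_succ] at hval
  simp only [hw, Fin.cons_zero, Fin.cons_succ] at hval
  have hyprod0 : (∏ j, y j ^ g' j.succ) ≠ 0 :=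
    Finset.prod_ne_zero_iff.mpr fun j _ => zpow_ne_zero _ (hy.1 j)
  have hrel : O.valuation (a ^ g' 0) = (O.valuation (∏ j, y j ^ g' j.succ))⁻¹ :=
    eq_inv_of_mul_eq_one_left (by rwa [map_mul] at hval)
  -- pass from the integer exponent `g'₀` to a natural one
  rcases Int.natAbs_eq (g' 0) with hpos | hneg
  · refine ⟨(g' 0).natAbs, Int.natAbs_ne_zero.mpr hg0, fun j => g' j.succ, Or.inr ?_⟩
    show O.valuation (a ^ (g' 0).natAbs) = O.valuation (∏ j, y j ^ g' j.succ)⁻¹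
    rw [← zpow_natCast, ← hpos, hrel, map_inv₀]
  · refine ⟨(g' 0).natAbs, Int.natAbs_ne_zero.mpr hg0, fun j => g' j.succ, Or.inl ?_⟩
    show O.valuation (a ^ (g' 0).natAbs) = O.valuation (∏ j, y j ^ g' j.succ)
    have h2 : ((g' 0).natAbs : ℤ) = -(g' 0) := by linarith
    have : a ^ ((g' 0).natAbs : ℕ) = (a ^ g' 0)⁻¹ := by
      rw [← zpow_natCast, h2, zpow_neg]
    rw [this, map_inv₀, hrel, inv_inv]

variable {F : Type u} [Field F] [Algebra F K]

/-- Value-independence is tested in `K`: for `y_j ∈ F`, `y` is value-independent for `O ∩ F` iff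
it is for `O`. [folklore] -/
theorem isValueIndependent_comap_iff {κ : Type*} (y : κ → F) :
    IsValueIndependent (O.comap (algebraMap F K)) y ↔
      IsValueIndependent O (fun j => algebraMap F K (y j)) := by
  unfold IsValueIndependent
  refine and_congr (forall_congr' fun j => (map_ne_zero_iff _ (algebraMap F K).injective).symm)
    (forall_congr' fun s => forall_congr' fun g => ?_)
  rw [valuation_comap_eq_one_iff]
  simp only [map_prod, map_zpow₀]

/-- **`E` does not increase under restriction to a subfield**: `E(O ∩ F) ≤ E(O)` (the value group
of `F` embeds into that of `K`). [folklore] -/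
theorem ratRank_comap_le : ratRank (O.comap (algebraMap F K)) ≤ ratRank O := by
  set O' := O.comap (algebraMap F K) with hO'
  show Module.rank ℤ (Additive (ValuationSubring.ValueGroup O')ˣ) ≤ _
  rw [Module.rank_def]
  haveI : Nonempty {s : Set (Additive (ValuationSubring.ValueGroup O')ˣ) // LinearIndepOn ℤ id s} :=
    ⟨⟨∅, linearIndepOn_empty ℤ id⟩⟩
  refine ciSup_le' fun s => ?_
  -- lift the values in `s` to elements of `F`
  choose y hy using fun a : s.1 => O'.valuation_surjective
    (((Additive.toMul (a : Additive (ValuationSubring.ValueGroup O')ˣ) :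
      (ValuationSubring.ValueGroup O')ˣ) : ValuationSubring.ValueGroup O'))
  have hy0 : ∀ a, y a ≠ 0 := by
    intro a h
    have := hy a
    rw [h, map_zero] at this
    exact (Units.ne_zero _) this.symm
  have hliF : LinearIndependent ℤ fun a : s.1 =>
      Additive.ofMul (Units.mk0 (O'.valuation (y a)) (valuation_ne_zero_of_ne_zero O' (hy0 a))) := by
    have : (fun a : s.1 => Additive.ofMul
        (Units.mk0 (O'.valuation (y a)) (valuation_ne_zero_of_ne_zero O' (hy0 a)))) =
        fun a : s.1 => (a : Additive (ValuationSubring.ValueGroup O')ˣ) :=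
      funext fun a => by
        have hu : Units.mk0 (O'.valuation (y a)) (valuation_ne_zero_of_ne_zero O' (hy0 a)) =
            Additive.toMul (a : Additive (ValuationSubring.ValueGroup O')ˣ) := Units.ext (hy a)
        rw [hu]; rfl
    rw [this]
    exact s.2
  have hind : IsValueIndependent O' y := (isValueIndependent_iff_linearIndependent O' y hy0).mpr hliF
  have hindK := (isValueIndependent_comap_iff O y).mp hind
  exact ((isValueIndependent_iff_linearIndependent O _ hindK.1).mp hindK).cardinal_le_rank

/-- **`E(O ∩ F) = E(O)` as soon as `F` contains a value basis**: if `F` contains a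
value-independent `y₁, …, y_e` with `e = E(O)` (finite), then `E(O ∩ F) = E(O)`. [folklore] -/
theorem ratRank_comap_eq_of_isValueIndependent {e : ℕ} (he : ratRank O = e) (y : Fin e → F)
    (hy : IsValueIndependent O (fun j => algebraMap F K (y j))) :
    ratRank (O.comap (algebraMap F K)) = e :=
  le_antisymm (he ▸ ratRank_comap_le O) ((isValueIndependent_comap_iff O y).mpr hy).natCast_le_ratRank

end valueIndependent

/-! ### Residue fields under restriction to a subfield -/

section residue

variable (k : Type u) [Field k] [Algebra k K] (O : ValuationSubring K)
variable {F : Type u} [Field F] [Algebra F K] [Algebra k F] [IsScalarTower k F K]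

/-- The residue field of `O ∩ F` embeds `k`-linearly into that of `O`. [folklore] -/
def residueFieldComapAlgHom (hk : ∀ c : k, algebraMap k K c ∈ O)
    (hkF : ∀ c : k, algebraMap k F c ∈ O.comap (algebraMap F K)) :
    letI := algebraOfMem k O hk
    letI := algebraOfMem k (O.comap (algebraMap F K)) hkF
    ResidueField (O.comap (algebraMap F K)) →ₐ[k] ResidueField O :=
  letI := algebraOfMem k O hk
  letI := algebraOfMem k (O.comap (algebraMap F K)) hkF
  { ResidueField.map (comapInclusion (F := F) O) with
    commutes' := fun c => by
      show ResidueField.map (comapInclusion O)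
          (residue _ (algebraMap k (O.comap (algebraMap F K)) c)) = residue O (algebraMap k O c)
      rw [ResidueField.map_residue]
      congr 1
      exact Subtype.ext (IsScalarTower.algebraMap_apply k F K c).symm }

/-- **`F` does not increase under restriction to a subfield**: `F(O ∩ F) ≤ F(O)`. [folklore] -/
theorem residueTrdeg_comap_le (hk : ∀ c : k, algebraMap k K c ∈ O)
    (hkF : ∀ c : k, algebraMap k F c ∈ O.comap (algebraMap F K)) :
    residueTrdeg k (O.comap (algebraMap F K)) hkF ≤ residueTrdeg k O hk := by
  letI := algebraOfMem k O hk
  letI := algebraOfMem k (O.comap (algebraMap F K)) hkF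
  let ψ := residueFieldComapAlgHom k O hk hkF
  exact trdeg_le_of_injective ψ ψ.toRingHom.injective

/-- **`F(O ∩ F) ≥ f` if `F` contains `f` elements of `O` with algebraically independent
residues.** [folklore] -/
theorem natCast_le_residueTrdeg_comap (hk : ∀ c : k, algebraMap k K c ∈ O)
    (hkF : ∀ c : k, algebraMap k F c ∈ O.comap (algebraMap F K)) {f : ℕ}
    (x : Fin f → O.comap (algebraMap F K))
    (hx : letI := algebraOfMem k O hk
      AlgebraicIndependent k fun i => residue O (comapInclusion O (x i))) :
    (f : Cardinal) ≤ residueTrdeg k (O.comap (algebraMap F K)) hkF := by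
  letI := algebraOfMem k O hk
  letI := algebraOfMem k (O.comap (algebraMap F K)) hkF
  let ψ := residueFieldComapAlgHom k O hk hkF
  have hcomp : (fun i => residue O (comapInclusion O (x i))) =
      ψ ∘ fun i => residue (O.comap (algebraMap F K)) (x i) := by
    funext i
    show _ = ResidueField.map (comapInclusion O) (residue _ (x i))
    rw [ResidueField.map_residue]
  rw [hcomp] at hx
  have h := (AlgebraicIndependent.of_comp ψ hx).lift_cardinalMk_le_trdeg
  unfold residueTrdeg
  simpa using h

end residue

/-! ### Transcendence degrees along a split transcendence basis -/

section trdeg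

variable {k : Type u} [Field k] [Algebra k K]

/-- Finite cardinal bookkeeping: `a + b = c`, `s ≤ a`, `t ≤ b`, `s + t = c < ℵ₀` force `a = s`,
`b = t`. [folklore] -/
theorem eq_and_eq_of_add_eq_of_le {a b c s t : Cardinal} (habc : a + b = c) (hsa : s ≤ a)
    (htb : t ≤ b) (hst : s + t = c) (hc : c < ℵ₀) : a = s ∧ b = t := by
  have ha : a < ℵ₀ := (le_self_add.trans_eq habc).trans_lt hc
  have hb : b < ℵ₀ := (le_add_self.trans_eq habc).trans_lt hc
  obtain ⟨a, rfl⟩ := Cardinal.lt_aleph0.mp ha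
  obtain ⟨b, rfl⟩ := Cardinal.lt_aleph0.mp hb
  obtain ⟨c, rfl⟩ := Cardinal.lt_aleph0.mp hc
  obtain ⟨s, rfl⟩ := Cardinal.lt_aleph0.mp (hsa.trans_lt ha)
  obtain ⟨t, rfl⟩ := Cardinal.lt_aleph0.mp (htb.trans_lt hb)
  norm_cast at habc hsa htb hst ⊢
  omega

variable {ι : Type u} (x : ι → K)

/-- A subfamily of an algebraically independent family is algebraically independent in the
subfield it generates: `#s ≤ tr.deg._k k(x(s))`. [folklore] -/
theorem cardinalMk_le_trdeg_adjoin (hx : AlgebraicIndependent k x) (s : Set ι) :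
    #s ≤ Algebra.trdeg k (IntermediateField.adjoin k (x '' s)) := by
  set L := IntermediateField.adjoin k (x '' s)
  have hmem : ∀ i : s, x i ∈ L := fun i =>
    IntermediateField.subset_adjoin k _ (Set.mem_image_of_mem x i.2)
  have h : AlgebraicIndependent k fun i : s => (⟨x i, hmem i⟩ : L) := by
    refine AlgebraicIndependent.of_comp L.val ?_
    exact hx.comp _ Subtype.val_injective
  exact h.cardinalMk_le_trdeg

/-- The rest of an algebraically independent family is algebraically independent over the
subfield generated by a part: `#sᶜ ≤ tr.deg._{k(x(s))} K`. [folklore] -/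
theorem cardinalMk_compl_le_trdeg_adjoin (hx : AlgebraicIndependent k x) (s : Set ι) :
    #(sᶜ : Set ι) ≤ Algebra.trdeg (IntermediateField.adjoin k (x '' s)) K := by
  have h := ((AlgebraicIndependent.iff_adjoin_image s).mp hx).2
  have h' : AlgebraicIndependent (IntermediateField.adjoin k (x '' s)) fun i : (sᶜ : Set ι) => x i :=
    IntermediateField.algebraicIndependent_adjoin_iff.mpr h
  exact h'.cardinalMk_le_trdeg

/-- **Splitting a finite transcendence basis.** If `x : ι → K` is a transcendence basis of `K/k`
with `ι` finite and `s ⊆ ι`, then `tr.deg._k k(x(s)) = #s` and `tr.deg._{k(x(s))} K = #sᶜ`.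
[folklore] -/
theorem trdeg_adjoin_eq_and_trdeg_eq (hx : IsTranscendenceBasis k x) (hι : #ι < ℵ₀) (s : Set ι) :
    Algebra.trdeg k (IntermediateField.adjoin k (x '' s)) = #s ∧
      Algebra.trdeg (IntermediateField.adjoin k (x '' s)) K = #(sᶜ : Set ι) := by
  set L := IntermediateField.adjoin k (x '' s)
  have hadd : Algebra.trdeg k L + Algebra.trdeg L K = Algebra.trdeg k K := trdeg_add_eq k L (A := K)
  have hN : Algebra.trdeg k K = #ι := hx.cardinalMk_eq_trdeg.symm
  refine eq_and_eq_of_add_eq_of_le (hadd.trans hN) (cardinalMk_le_trdeg_adjoin x hx.1 s)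
    (cardinalMk_compl_le_trdeg_adjoin x hx.1 s) ?_ hι
  exact Cardinal.mk_sum_compl s

end trdeg


/-! ### Subfields containing an Abhyankar system -/

section system

variable (k : Type u) [Field k] [Algebra k K] (O : ValuationSubring K)
  (hk : ∀ c : k, algebraMap k K c ∈ O)

/-- **Existence of an Abhyankar system** (Temkin 2013, §2.1, p. 9, condition (*): "`B = B_E ⊔ B_F`,
`|b| = 1` for any `b ∈ B_F` and the reduction maps `B_F` bijectively onto a transcendence basis
`B̃_F` of `l̃` over `k̃`, and the projection … maps `B_E` bijectively onto a `ℚ`-basis"), for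
`tr.deg._k(K) < ℵ₀` (so that `E`, `F` are finite): there are a value-independent `y : Fin E → K`
and `x : Fin F → O` whose residues form a transcendence basis of `K̃/k`. [cite: Temkin2013, Section 2.1 (p. 9)] -/
theorem exists_abhyankar_system (hN : Algebra.trdeg k K < ℵ₀) :
    ∃ (e f : ℕ) (y : Fin e → K) (x : Fin f → O), ratRank O = e ∧ residueTrdeg k O hk = f ∧
      IsValueIndependent O y ∧
      (letI := algebraOfMem k O hk; IsTranscendenceBasis k fun i => residue O (x i)) := by
  letI := algebraOfMem k O hk
  haveI := isScalarTower_algebraOfMem k O hk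
  obtain ⟨e, he⟩ := Cardinal.lt_aleph0.mp (ratRank_lt_aleph0 O hk hN)
  obtain ⟨f, hf⟩ := Cardinal.lt_aleph0.mp (residueTrdeg_lt_aleph0 O hk hN)
  obtain ⟨y, hy⟩ := exists_isValueIndependent_of_natCast_le_ratRank O he.symm.le
  -- a finite transcendence basis of the residue field
  haveI : FaithfulSMul k (ResidueField O) :=
    (faithfulSMul_iff_algebraMap_injective k (ResidueField O)).mpr (algebraMap k _).injective
  obtain ⟨t, ht⟩ := exists_isTranscendenceBasis k (ResidueField O)
  have htf : #t = f := by
    rw [ht.cardinalMk_eq_trdeg, ← residueTrdeg_eq O hk, hf]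
  obtain ⟨eqv⟩ := Cardinal.mk_eq_nat_iff.mp htf
  have ht' : IsTranscendenceBasis k (((↑) : t → ResidueField O) ∘ eqv.symm) :=
    (isTranscendenceBasis_equiv eqv.symm).mpr ht
  choose x hx using fun i : Fin f => residue_surjective ((((↑) : t → ResidueField O) ∘ eqv.symm) i)
  refine ⟨e, f, y, x, he, hf, hy, ?_⟩
  have : (fun i => residue O (x i)) = ((↑) : t → ResidueField O) ∘ eqv.symm := funext hx
  rw [this]
  exact ht'

variable {k O}
variable {e f : ℕ} {y : Fin e → K} {x : Fin f → O}

/-- An Abhyankar system is algebraically independent over `k` (Temkin 2013, p. 10: "the elements of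
`B` are algebraically independent over `k`"; `algebraicIndependent_sumElim_of_valuation`).
[cite: Temkin2013, Section 2.1 (p. 10)] -/
theorem algebraicIndependent_abhyankar_system (hy : IsValueIndependent O y)
    (hx : letI := algebraOfMem k O hk; IsTranscendenceBasis k fun i => residue O (x i)) :
    AlgebraicIndependent k (Sum.elim y fun i => (x i : K)) := by
  letI := algebraOfMem k O hk
  haveI := isScalarTower_algebraOfMem k O hk
  exact algebraicIndependent_sumElim_of_valuation O x hx.1 y (hy.injective_prod_pow O)

/-- … hence has `E + F` elements. [folklore] -/
theorem cardinalMk_range_abhyankar_system (hy : IsValueIndependent O y)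
    (hx : letI := algebraOfMem k O hk; IsTranscendenceBasis k fun i => residue O (x i)) :
    #(Set.range (Sum.elim y fun i => (x i : K))) = e + f := by
  have hinj := (algebraicIndependent_abhyankar_system hk hy hx).injective
  simpa using Cardinal.mk_range_eq_of_injective hinj

variable (L : IntermediateField k K) (hyL : ∀ j, y j ∈ L) (hxL : ∀ i, (x i : K) ∈ L)

include hk in
/-- `k ⊆ O ∩ L`. [folklore] -/
theorem algebraMap_mem_comap (c : k) :
    algebraMap k L c ∈ O.comap (algebraMap L K) := by
  rw [ValuationSubring.mem_comap, ← IsScalarTower.algebraMap_apply]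
  exact hk c

include hyL in
/-- **`E(L) = E(K)`** for an intermediate field containing the value part of an Abhyankar system.
[folklore] -/
theorem ratRank_comap_intermediateField (he : ratRank O = e) (hy : IsValueIndependent O y) :
    ratRank (O.comap (algebraMap L K)) = e :=
  ratRank_comap_eq_of_isValueIndependent O he (fun j => ⟨y j, hyL j⟩) hy

include hxL in
/-- **`F(L) = F(K)`** for an intermediate field containing the residue part of an Abhyankar
system. [folklore] -/
theorem residueTrdeg_comap_intermediateField
    (hx : letI := algebraOfMem k O hk; IsTranscendenceBasis k fun i => residue O (x i)) :
    residueTrdeg k (O.comap (algebraMap L K)) (algebraMap_mem_comap hk L) = f := by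
  refine le_antisymm ?_ ?_
  · refine (residueTrdeg_comap_le k O hk _).trans_eq ?_
    letI := algebraOfMem k O hk
    haveI := isScalarTower_algebraOfMem k O hk
    rw [residueTrdeg_eq O hk]
    have h := hx.lift_cardinalMk_eq_trdeg
    simp only [Cardinal.mk_fintype, Fintype.card_fin, Cardinal.lift_natCast,
      Cardinal.lift_uzero] at h
    exact h.symm
  · let x' : Fin f → O.comap (algebraMap L K) := fun i => ⟨⟨x i, hxL i⟩, (x i).2⟩
    have hxx' : ∀ i, comapInclusion O (x' i) = x i := fun i => Subtype.ext rfl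
    refine natCast_le_residueTrdeg_comap k O hk _ x' ?_
    have : (fun i => residue O (comapInclusion O (x' i))) = fun i => residue O (x i) :=
      funext fun i => by rw [hxx']
    rw [this]
    exact hx.1

include hyL in
/-- **The value group of `K` is torsion over that of `L`** when `L` contains the value part of an
Abhyankar system. [folklore] -/
theorem isValueTorsionOver_intermediateField (he : ratRank O = e) (hy : IsValueIndependent O y) :
    IsValueTorsionOver O L.toSubfield ⊤ := by
  intro a _ ha
  obtain ⟨n, hn, g, h⟩ := hy.exists_pow_valuation_eq O he ha
  have hmem : (∏ j, y j ^ g j) ∈ L.toSubfield :=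
    prod_mem fun j _ => zpow_mem (hyL j) _
  rcases h with h | h
  · exact ⟨n, hn, _, hmem, h⟩
  · exact ⟨n, hn, _, inv_mem hmem, h⟩

include hxL in
/-- **The residue field of `K` is algebraic over that of `L`** when `L` contains the residue part
of an Abhyankar system. [folklore] -/
theorem isResiduallyAlgebraicOver_intermediateField
    (hx : letI := algebraOfMem k O hk; IsTranscendenceBasis k fun i => residue O (x i)) :
    IsResiduallyAlgebraicOver O L.toSubfield ⊤ := by
  letI := algebraOfMem k O hk
  haveI := isScalarTower_algebraOfMem k O hk
  intro r _
  -- the residue field `L̃ ⊆ K̃` of `L`, as an intermediate field of `K̃/k`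
  have hkT : ∀ c : k, algebraMap k (ResidueField O) c ∈ resField O L.toSubfield := by
    intro c
    rw [IsScalarTower.algebraMap_apply k O (ResidueField O), ResidueField.algebraMap_eq]
    refine residue_mem_resField O _ ?_
    change algebraMap k K c ∈ L
    exact L.algebraMap_mem c
  set T := (resField O L.toSubfield).toIntermediateField hkT with hT
  set R₀ := Algebra.adjoin k (Set.range fun i => residue O (x i)) with hR₀
  haveI halg : Algebra.IsAlgebraic R₀ (ResidueField O) := hx.isAlgebraic
  have hle : R₀ ≤ T.toSubalgebra := by
    refine Algebra.adjoin_le ?_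
    rintro _ ⟨i, rfl⟩
    exact residue_mem_resField O (x i) (hxL i)
  letI : Algebra R₀ T := (Subalgebra.inclusion hle).toRingHom.toAlgebra
  haveI : IsScalarTower R₀ T (ResidueField O) := IsScalarTower.of_algebraMap_eq fun _ => rfl
  have h : IsAlgebraic T r :=
    (halg.isAlgebraic r).extendScalars (Subalgebra.inclusion_injective hle)
  exact h

include hyL hxL in
/-- **`K/L` is transcendentally immediate** for every intermediate field `L` containing an
Abhyankar system (Temkin 2013, Remark 2.1.2: "`l/k` splits to a tower `l/k(B)/k` with …
transcendentally immediate top level"; here for any `L ⊇ k(B)`). [cite: Temkin2013, Remark 2.1.2] -/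
theorem isTranscendentallyImmediateOver_intermediateField (he : ratRank O = e)
    (hy : IsValueIndependent O y)
    (hx : letI := algebraOfMem k O hk; IsTranscendenceBasis k fun i => residue O (x i)) :
    IsTranscendentallyImmediateOver O L.toSubfield ⊤ :=
  ⟨isValueTorsionOver_intermediateField L hyL he hy,
    isResiduallyAlgebraicOver_intermediateField hk L hxL hx⟩

end system


/-! ### Remark 2.1.2 and the fibration of the proof of Thm. 4.1.1 (Step 1) -/

section main

variable (k : Type u) [Field k] [Algebra k K] (O : ValuationSubring K)
  (hk : ∀ c : k, algebraMap k K c ∈ O)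

/-- **Temkin 2013, Remark 2.1.2** ("Choose any `B = B_E ⊔ B_F` that satisfies (*). Then the
extension `l/k` splits to a tower `l/k(B)/k` with Abhyankar bottom level and transcendentally
immediate top level. In particular, one can define `D_{l/k}` for a general extension `l/k` as
`tr.deg._{k(B)}(l)`, and this agrees with the above definition when `tr.deg._k(l) < ∞`"), for a
valued field `(K, O)` over a trivially valued subfield `k ⊆ O` with `tr.deg._k(K) < ℵ₀`, PROVED:
there is an algebraically independent `B ⊆ K` with `#B = E + F` such that `K/k(B)` is
transcendentally immediate, `k(B)` is Abhyankar (`D_{k(B)/k} = 0`, with `E_{k(B)} = E`,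
`F_{k(B)} = F`, `tr.deg._k k(B) = E + F`), and `tr.deg._{k(B)}(K) = D_{K/k}`.
[cite: Temkin2013, Remark 2.1.2] -/
theorem exists_adjoin_isTranscendentallyImmediateOver (hN : Algebra.trdeg k K < ℵ₀) :
    ∃ B : Set K, AlgebraicIndepOn k id B ∧ #B = ratRank O + residueTrdeg k O hk ∧
      IsTranscendentallyImmediateOver O (IntermediateField.adjoin k B).toSubfield ⊤ ∧
      transcendenceDefect k (O.comap (algebraMap (IntermediateField.adjoin k B) K))
          (algebraMap_mem_comap hk _) = 0 ∧
      ratRank (O.comap (algebraMap (IntermediateField.adjoin k B) K)) = ratRank O ∧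
      residueTrdeg k (O.comap (algebraMap (IntermediateField.adjoin k B) K))
          (algebraMap_mem_comap hk _) = residueTrdeg k O hk ∧
      Algebra.trdeg k (IntermediateField.adjoin k B) = ratRank O + residueTrdeg k O hk ∧
      Algebra.trdeg (IntermediateField.adjoin k B) K = transcendenceDefect k O hk := by
  obtain ⟨e, f, y, x, he, hf, hy, hx⟩ := exists_abhyankar_system k O hk hN
  set v := Sum.elim y fun i => (x i : K) with hv
  have hind : AlgebraicIndependent k v := algebraicIndependent_abhyankar_system hk hy hx
  have hBind : AlgebraicIndepOn k id (Set.range v) := hind.to_subtype_range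
  have hBcard : #(Set.range v) = e + f := cardinalMk_range_abhyankar_system hk hy hx
  -- a transcendence basis of `K/k` through `B`
  obtain ⟨t, hBt, ht⟩ := exists_isTranscendenceBasis_superset hBind
  have htN : #t = Algebra.trdeg k K := ht.cardinalMk_eq_trdeg
  obtain ⟨N, hNN⟩ := Cardinal.lt_aleph0.mp hN
  have htfin : #t < ℵ₀ := by rw [htN]; exact hN
  set s : Set t := {i | (i : K) ∈ Set.range v} with hsdef
  have hs : ((↑) : t → K) '' s = Set.range v := by
    ext b
    constructor
    · rintro ⟨i, hi, rfl⟩; exact hi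
    · intro hb; exact ⟨⟨b, hBt hb⟩, hb, rfl⟩
  obtain ⟨h1, h2⟩ := trdeg_adjoin_eq_and_trdeg_eq ((↑) : t → K) ht htfin s
  rw [hs] at h1 h2
  have hscard : #s = e + f := by
    rw [← Cardinal.mk_image_eq (s := s) Subtype.val_injective, hs, hBcard]
  obtain ⟨c, hc⟩ := Cardinal.lt_aleph0.mp ((Cardinal.mk_le_mk_of_subset
    (Set.subset_univ (sᶜ : Set t))).trans_lt (by simpa using htfin))
  have hsum : #s + #(sᶜ : Set t) = #t := Cardinal.mk_sum_compl s
  rw [hscard, hc, htN, hNN] at hsum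
  norm_cast at hsum
  set L := IntermediateField.adjoin k (Set.range v) with hL
  have hyL : ∀ j, y j ∈ L := fun j =>
    IntermediateField.subset_adjoin k (Set.range v) ⟨Sum.inl j, rfl⟩
  have hxL : ∀ i, (x i : K) ∈ L := fun i =>
    IntermediateField.subset_adjoin k (Set.range v) ⟨Sum.inr i, rfl⟩
  have hE := ratRank_comap_intermediateField L hyL he hy
  have hF := residueTrdeg_comap_intermediateField hk L hxL hx
  have hD : transcendenceDefect k O hk = N - e - f := by
    unfold transcendenceDefect
    rw [hNN, he, hf]
    simp only [Cardinal.toNat_natCast]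
  refine ⟨Set.range v, hBind, ?_, ?_, ?_, ?_, ?_, ?_, ?_⟩
  · rw [hBcard, he, hf]
  · exact isTranscendentallyImmediateOver_intermediateField hk L hyL hxL he hy hx
  · unfold transcendenceDefect
    rw [h1, hscard, hE, hF]
    simp only [← Nat.cast_add, Cardinal.toNat_natCast]
    omega
  · rw [hE, he]
  · rw [hF, hf]
  · rw [h1, hscard, he, hf]
  · rw [h2, hc, hD]
    norm_cast
    omega

/-- **Temkin 2013, proof of Thm. 4.1.1, Step 1, first sentence** ("Since `D_{K/k} > 0`, it follows
from Remark 2.1.2 that there exists a valued subfield `k̄ ↪ K` containing `k` and such that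
`tr.deg._{k̄}(K) = 1` and `K/k̄` is transcendentally immediate; in particular,
`D_{k̄/k} = D - 1`", p. 47; the same fibration is Step 1 of §4.2, p. 50), PROVED for `K/k`
finitely generated: take an Abhyankar system `B` (`#B = E + F < N = tr.deg._k(K)` because
`D > 0`), a transcendence basis `T ⊇ B` of `K/k`, `c₀ ∈ T ∖ B`, and `k̄ := k(T ∖ {c₀})`; then
`k̄/k` is finitely generated, `tr.deg._{k̄}(K) = 1`, `tr.deg._k(k̄) = N - 1`, `K/k̄` is
transcendentally immediate (`k̄ ⊇ B`), `E_{k̄} = E`, `F_{k̄} = F`, hence `D_{k̄/k} = D - 1` (for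
the valuation ring `O ∩ k̄` of `k̄`). [cite: Temkin2013, proof of Thm. 4.1.1, Step 1 (p. 47)] -/
theorem exists_intermediateField_trdeg_eq_one_isTranscendentallyImmediateOver
    (hfg : (⊤ : IntermediateField k K).FG) (hD : 0 < transcendenceDefect k O hk) :
    ∃ L : IntermediateField k K, L.FG ∧ Algebra.trdeg L K = 1 ∧
      IsTranscendentallyImmediateOver O L.toSubfield ⊤ ∧
      transcendenceDefect k (O.comap (algebraMap L K)) (algebraMap_mem_comap hk L) + 1 =
        transcendenceDefect k O hk ∧
      ratRank (O.comap (algebraMap L K)) = ratRank O ∧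
      residueTrdeg k (O.comap (algebraMap L K)) (algebraMap_mem_comap hk L) =
        residueTrdeg k O hk ∧
      Algebra.trdeg k L + 1 = Algebra.trdeg k K := by
  have hN : Algebra.trdeg k K < ℵ₀ := trdeg_lt_aleph0_of_fg hfg
  obtain ⟨e, f, y, x, he, hf, hy, hx⟩ := exists_abhyankar_system k O hk hN
  set v := Sum.elim y fun i => (x i : K) with hv
  have hind : AlgebraicIndependent k v := algebraicIndependent_abhyankar_system hk hy hx
  have hBind : AlgebraicIndepOn k id (Set.range v) := hind.to_subtype_range
  have hBcard : #(Set.range v) = e + f := cardinalMk_range_abhyankar_system hk hy hx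
  -- a transcendence basis of `K/k` through `B`
  obtain ⟨t, hBt, ht⟩ := exists_isTranscendenceBasis_superset hBind
  have htN : #t = Algebra.trdeg k K := ht.cardinalMk_eq_trdeg
  obtain ⟨N, hNN⟩ := Cardinal.lt_aleph0.mp hN
  have htfin : #t < ℵ₀ := by rw [htN]; exact hN
  have htN' : #t = N := by rw [htN, hNN]
  have hD' : transcendenceDefect k O hk = N - e - f := by
    unfold transcendenceDefect
    rw [hNN, he, hf]
    simp only [Cardinal.toNat_natCast]
  -- `D > 0`: the basis is strictly bigger than `B`
  have hlt : e + f < N := by rw [hD'] at hD; omega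
  have hc₀ : ∃ c₀ ∈ t, c₀ ∉ Set.range v := by
    by_contra hcon
    push Not at hcon
    have hle : #t ≤ #(Set.range v) := Cardinal.mk_le_mk_of_subset hcon
    rw [htN', hBcard] at hle
    norm_cast at hle
    omega
  obtain ⟨c₀, hc₀t, hc₀B⟩ := hc₀
  -- `k̄ := k(T ∖ {c₀})`
  set s : Set t := {i | (i : K) ≠ c₀} with hsdef
  have hs : ((↑) : t → K) '' s = (t : Set K) \ {c₀} := by
    ext b
    simp only [Set.mem_image, Set.mem_sdiff, Set.mem_singleton_iff, hsdef, Set.mem_setOf_eq]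
    constructor
    · rintro ⟨i, hi, rfl⟩; exact ⟨i.2, hi⟩
    · rintro ⟨hb, hb'⟩; exact ⟨⟨b, hb⟩, hb', rfl⟩
  have hsc : (sᶜ : Set t) = {⟨c₀, hc₀t⟩} := by
    ext i
    simp only [Set.mem_compl_iff, hsdef, Set.mem_setOf_eq, not_not, Set.mem_singleton_iff]
    constructor
    · intro h; exact Subtype.ext h
    · intro h; rw [h]
  obtain ⟨h1, h2⟩ := trdeg_adjoin_eq_and_trdeg_eq ((↑) : t → K) ht htfin s
  rw [hs] at h1 h2
  rw [hsc, Cardinal.mk_singleton] at h2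
  have hsum : #s + #(sᶜ : Set t) = #t := Cardinal.mk_sum_compl s
  rw [hsc, Cardinal.mk_singleton, htN'] at hsum
  obtain ⟨m, hm⟩ := Cardinal.lt_aleph0.mp ((Cardinal.mk_le_mk_of_subset
    (Set.subset_univ s)).trans_lt (by simpa using htfin))
  rw [hm] at hsum h1
  norm_cast at hsum
  set L := IntermediateField.adjoin k ((t : Set K) \ {c₀}) with hL
  have hBL : Set.range v ⊆ L := fun b hb =>
    IntermediateField.subset_adjoin k _ ⟨hBt hb, fun h => hc₀B (h ▸ hb)⟩
  have hyL : ∀ j, y j ∈ L := fun j => hBL ⟨Sum.inl j, rfl⟩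
  have hxL : ∀ i, (x i : K) ∈ L := fun i => hBL ⟨Sum.inr i, rfl⟩
  have hE := ratRank_comap_intermediateField L hyL he hy
  have hF := residueTrdeg_comap_intermediateField hk L hxL hx
  have htfinite : (t : Set K).Finite := Cardinal.lt_aleph0_iff_set_finite.mp htfin
  refine ⟨L, IntermediateField.fg_adjoin_of_finite (htfinite.subset Set.sdiff_subset), h2,
    isTranscendentallyImmediateOver_intermediateField hk L hyL hxL he hy hx, ?_, ?_, ?_, ?_⟩
  · unfold transcendenceDefect
    rw [h1, hE, hF, hNN, he, hf]
    simp only [Cardinal.toNat_natCast]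
    omega
  · rw [hE, he]
  · rw [hF, hf]
  · rw [h1, hNN]
    norm_cast

end main


/-! ### A residually generating subfield on which the valuation is trivial (§4.2, Step 1) -/

section residualSubfield

variable (k : Type u) [Field k] [Algebra k K] (O : ValuationSubring K)
  (hk : ∀ c : k, algebraMap k K c ∈ O)

/-- The valuation is trivial on the subfield generated by elements of `O` with algebraically
independent residues: non-zero elements of `k(x)` have value `1` (so `k(x) ⊆ O`).
[folklore] -/
theorem valuation_eq_one_of_mem_intermediateField_adjoin {ι : Type*} (x : ι → O)
    (hx : letI := algebraOfMem k O hk; AlgebraicIndependent k fun i => residue O (x i)) {z : K}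
    (hz : z ∈ IntermediateField.adjoin k (Set.range fun i => (x i : K))) (hz0 : z ≠ 0) :
    O.valuation z = 1 := by
  letI := algebraOfMem k O hk
  haveI := isScalarTower_algebraOfMem k O hk
  obtain ⟨r, hr, q, hq, rfl⟩ := IntermediateField.mem_adjoin_iff_div.mp hz
  have hr0 : r ≠ 0 := fun h => hz0 (by rw [h, zero_div])
  have hq0 : q ≠ 0 := fun h => hz0 (by rw [h, div_zero])
  rw [map_div₀, valuation_eq_one_of_mem_adjoin O x hx hr hr0,
    valuation_eq_one_of_mem_adjoin O x hx hq hq0, div_one]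

/-- **Temkin 2013, §4.2, Step 1, the choice of `k̄ = k(b)`** ("Choose a subset
`b = {b₁, …, b_d} ⊂ F°` such that `d = tr.deg._k(F̃)` and `b̃` is a transcendence basis of `F̃`
over `k`. It then follows that `F°` contains a subfield `k̄ = k(b)`, and hence `F` induces a
trivial valuation on `k̄`", p. 50; also "`F̃` is algebraic over `k̄`", used there to see that the
centre is a closed point of the generic fibre), PROVED for any valuation ring `O ⊇ k` of `K` with
`tr.deg._k(K) < ℵ₀`: there is a finitely generated intermediate field `k̄ = k(b)`, `b ⊂ O` lifting
a transcendence basis of the residue field `K̃ = O/𝔪_O` over `k`, with `tr.deg._k(k̄) = F_{K/k}`,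
on which the valuation of `O` is trivial (`v(z) = 1` for `z ∈ k̄^×`; in particular `k̄ ⊆ O`), and
over whose residue field `K̃` is algebraic. [cite: Temkin2013, Section 4.2, Step 1 (p. 50)] -/
theorem exists_intermediateField_valuation_eq_one_isResiduallyAlgebraicOver
    (hN : Algebra.trdeg k K < ℵ₀) :
    ∃ (f : ℕ) (b : Fin f → O), residueTrdeg k O hk = f ∧
      (letI := algebraOfMem k O hk; IsTranscendenceBasis k fun i => residue O (b i)) ∧
      (IntermediateField.adjoin k (Set.range fun i => (b i : K))).FG ∧
      Algebra.trdeg k (IntermediateField.adjoin k (Set.range fun i => (b i : K))) = f ∧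
      (∀ z ∈ IntermediateField.adjoin k (Set.range fun i => (b i : K)), z ≠ 0 →
        O.valuation z = 1) ∧
      (∀ z ∈ IntermediateField.adjoin k (Set.range fun i => (b i : K)), z ∈ O) ∧
      IsResiduallyAlgebraicOver O
        (IntermediateField.adjoin k (Set.range fun i => (b i : K))).toSubfield ⊤ := by
  obtain ⟨e, f, y, x, he, hf, hy, hx⟩ := exists_abhyankar_system k O hk hN
  set L := IntermediateField.adjoin k (Set.range fun i => (x i : K)) with hL
  have hxL : ∀ i, (x i : K) ∈ L := fun i => IntermediateField.subset_adjoin k _ ⟨i, rfl⟩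
  -- `x` is algebraically independent in `K`
  have hind : AlgebraicIndependent k fun i => (x i : K) := by
    letI := algebraOfMem k O hk
    haveI := isScalarTower_algebraOfMem k O hk
    exact algebraicIndependent_of_residue O x hx.1
  have hval : ∀ z ∈ L, z ≠ 0 → O.valuation z = 1 := fun z hz hz0 =>
    valuation_eq_one_of_mem_intermediateField_adjoin k O hk x hx.1 hz hz0
  have hLO : ∀ z ∈ L, z ∈ O := by
    intro z hz
    by_cases hz0 : z = 0
    · rw [hz0]; exact O.zero_mem
    · exact (O.valuation_le_one_iff z).mp (hval z hz hz0).le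
  -- `tr.deg._k k(x) = f`: split a transcendence basis through `range x`
  have hBind : AlgebraicIndepOn k id (Set.range fun i => (x i : K)) := hind.to_subtype_range
  obtain ⟨t, hBt, ht⟩ := exists_isTranscendenceBasis_superset hBind
  have htfin : #t < ℵ₀ := by rw [ht.cardinalMk_eq_trdeg]; exact hN
  set s : Set t := {i | (i : K) ∈ Set.range fun i => (x i : K)} with hsdef
  have hs : ((↑) : t → K) '' s = Set.range fun i => (x i : K) := by
    ext b
    constructor
    · rintro ⟨i, hi, rfl⟩; exact hi
    · intro hb; exact ⟨⟨b, hBt hb⟩, hb, rfl⟩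
  obtain ⟨h1, -⟩ := trdeg_adjoin_eq_and_trdeg_eq ((↑) : t → K) ht htfin s
  rw [hs] at h1
  have hscard : #s = f := by
    rw [← Cardinal.mk_image_eq (s := s) Subtype.val_injective, hs]
    simpa using Cardinal.mk_range_eq_of_injective hind.injective
  refine ⟨f, x, hf, hx, IntermediateField.fg_adjoin_of_finite (Set.finite_range _), ?_, hval, hLO,
    isResiduallyAlgebraicOver_intermediateField hk L hxL hx⟩
  rw [h1, hscard]

end residualSubfield

end Literature.AlgebraicGeometry.Resolution

end
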